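import Summits.QuantumFields.YangMills.Theses.RenyiTelescope
import Summits.QuantumFields.YangMills.Theorems.RenyiTelescopeConditionalTelescope
import Summits.QuantumFields.YangMills.Theorems.RenyiTelescopePlaquetteTransport
import Summits.QuantumFields.YangMills.Theorems.RenyiTelescopeUnitEventReduction
import Summits.QuantumFields.YangMills.Theorems.RenyiTelescopeAbstractBootstrap
import Summits.QuantumFields.YangMills.Theorems.RenyiTelescopeInteriorComplement
import Summits.QuantumFields.YangMills.Theorems.RenyiTelescopeTelescopedCruxR
import Summits.QuantumFields.YangMills.Theorems.RenyiTelescopeArithClosureR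
import Summits.QuantumFields.YangMills.Theorems.RenyiTelescopeGlueRestR

/-!
# Route `RenyiTelescope` — THE RE-GLUE ITEM `HistoryTailOfRenyiTelescopeR` (stmt-QuantumFields-27545, support r9), PROVED
# (width seat `ym-line-sfw-p2-w3` g23 for planner seat `ym-r3-idea-2` g3, with `ym-line-sfw-p2-w2` g19 (arithmetic closure);
# the sorry-free composition of the registered skeleton v8)

`HistoryTailOfRenyiTelescopeR : CutoffRenyiLR → FineRegimeUnitTailL → UnitScaleTilt.HistoryTailL` — after the REPAIR of 2026-08-28
(`CutoffRenyiL`, stmt-QuantumFields-27137, exponent `L^(−4J)` / orders `≤ Q·L^(2J)`, predicted false as typed by the one-loop `O(g²a)` coupling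
renormalisation in `d = 3` [Moore 1998, arXiv:hep-lat/9709053]; replaced by `CutoffRenyiLR`, stmt-QuantumFields-27544, exponent
`R₀(q−1)p⁴L^(3F.m)(γ²/L^(2J) + 1/L^(4J))`, orders `≤ Q·L^J`) the two CRUXES of LINE «RenyiTelescope» still imply the history-tail crux
`HistoryTailL` of route `UnitScaleTilt` (stmt-QuantumFields-19936): refinement trades cut-off for coupling (`γ_d² = γ²L^(−2d)` against the volume
`L^(3(F.m+d))`).  Composition of the landed pieces: conditional telescope (p622611) · plaquette-event transport (p623159) · unit-event reduction
(p623509) · abstract bootstrap (p623811) · interior complement (p623983) — all crux-independent, reused BY NAME — and the three re-derived stubs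
of skeleton v8: telescoped repaired crux (`stub_telescopedCruxR`, p627810, orders `q_J = κ(3/2)^J`) · arithmetic closure (`stub_arithClosureR`,
p627824, `J₀(d) = d − ⌊d/8⌋`) · instantiation (`stub_glueRestR`, p628443, `κ := Q`, `Λ := (4/3)R₀Q`).

WHAT THIS IS NOT: the cruxes `CutoffRenyiLR` (stmt-QuantumFields-27544) and `FineRegimeUnitTailL` (stmt-QuantumFields-27138) are OPEN; this is an
implication between route items, not a Gibbs-measure estimate; `HistoryTailL`, the rung R3 (`YM3TorusSU2`) and the mass gap are NOT proved.

References: T. Bałaban, CMP 102 (1985) 255–275 [Balaban1985UV3] ((7) p.257, (60) p.270, (71) p.273); C. King, CMP 103 (1986) 323–349 [King1986]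
(Thm 3.4 p.334); G. D. Moore, Nucl. Phys. B523 (1998) 569 [arXiv:hep-lat/9709053].
-/

namespace Summit.QuantumFields.YangMills.Theorems

/-- **THE RE-GLUE OF LINE «RenyiTelescope»**: `CutoffRenyiLR → FineRegimeUnitTailL → HistoryTailL` (item stmt-QuantumFields-27545 BY NAME).
[cite: Balaban1985UV3, (7) p.257 and (71) p.273; King1986, Thm 3.4 p.334] -/
theorem historyTailOfRenyiTelescopeR : Summit.QuantumFields.YangMills.Theses.RenyiTelescope.HistoryTailOfRenyiTelescopeR :=
  fun hC hF => RenyiTelescope.stub_unitEventReduction RenyiTelescope.stub_plaquetteTransport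
    (RenyiTelescope.stub_glueRestR (RenyiTelescope.stub_telescopedCruxR hC RenyiTelescope.stub_conditionalTelescope) hF
      RenyiTelescope.stub_abstractBootstrap RenyiTelescope.stub_interiorComplement RenyiTelescope.stub_arithClosureR)

end Summit.QuantumFields.YangMills.Theorems
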